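import Literature.Probability.Distributions.GaussianCoordinateMoments
import Literature.Analysis.UnboundedOperators.LinearizedBoltzmannSphereAverages
import HarnessLib

/-!
# Directional derivatives of Wick polynomials: the quadratic and quartic direction forms

For an orthonormal basis `b` (indexed by `ι`, `|ι| = d`) of the finite-dimensional real inner
product space `E`, a direction `u ∈ E` and a real polynomial `q` in the variables `ι`, the
*directional derivative polynomial* is `D_u q = Σⱼ ⟪bⱼ, u⟫ ∂ⱼ q` (`dirPoly b u q`), so that
`fderiv (𝓗_b q) v u = 𝓗_b (D_u q) v` (`GaussianHermiteChaos.fderiv_hermiteEval_apply`). We study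
the two nonnegative homogeneous forms of the direction

* `A_q(u) = ‖D_u q‖²_F` (degree 2) and `B_q(u) = ‖D_u D_u q‖²_F` (degree 4),

prove their expansions in coordinates, their Gaussian expectations
`∫ A_q dγ = Σⱼ ‖∂ⱼ q‖²_F`, `∫ B_q dγ = ‖Δ q‖²_F + 2 Σⱼₖ ‖∂ⱼ∂ₖ q‖²_F` (Wick's formula,
`GaussianCoordinateMoments`), and hence their **sphere averages**
(`LinearizedBoltzmannSphereAverages.moment_mul_integral_sphere_eq`): for `q` homogeneous of degree `n`,

* `d · ∫_S A_q dσ = σ(S) · n ‖q‖²_F` (`integral_sphere_dirFormA`),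
* `d (d + 2) · ∫_S B_q dσ = σ(S) · (‖Δq‖²_F + 2 n (n - 1) ‖q‖²_F)` (`integral_sphere_dirFormB`).

These are the averaging identities of the spectral-gap proof for the linearised Boltzmann operator
(`LinearizedBoltzmann.le_neg_maxwellianInner_hardSphereLinearizedOp_of_orthogonal`).
-/

open MeasureTheory Metric Real Set ProbabilityTheory Module Finset
open scoped InnerProductSpace ENNReal

namespace Literature.Analysis.UnboundedOperators

noncomputable section

open Literature.MathematicalPhysics.KineticTheory (sphereMeasure)
open Literature.Algebra.Polynomial Literature.Probability.Distributions

variable {E : Type*} [NormedAddCommGroup E] [InnerProductSpace ℝ E]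
variable {ι : Type*} [Fintype ι] [DecidableEq ι]

/-! ### The directional derivative polynomial -/

/-- The directional derivative polynomial `D_u q = Σⱼ ⟪bⱼ, u⟫ ∂ⱼ q`. [folklore] -/
def dirPoly (b : OrthonormalBasis ι ℝ E) (u : E) (q : MvPolynomial ι ℝ) : MvPolynomial ι ℝ :=
  ∑ j, ⟪b j, u⟫_ℝ • MvPolynomial.pderiv j q

/-- `fderiv (𝓗_b q) v u = 𝓗_b (D_u q) v`. [folklore] -/
theorem fderiv_hermiteEval_eq_dirPoly (b : OrthonormalBasis ι ℝ E) (q : MvPolynomial ι ℝ)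
    (v u : E) : fderiv ℝ (hermiteEval b q) v u = hermiteEval b (dirPoly b u q) v :=
  fderiv_hermiteEval_apply b q v u

omit [DecidableEq ι] in
/-- `D_u` is additive in `q`. [folklore] -/
theorem dirPoly_add (b : OrthonormalBasis ι ℝ E) (u : E) (q q' : MvPolynomial ι ℝ) :
    dirPoly b u (q + q') = dirPoly b u q + dirPoly b u q' := by
  simp [dirPoly, smul_add, Finset.sum_add_distrib]

omit [DecidableEq ι] in
/-- `D_u` commutes with scalars in `q`. [folklore] -/
theorem dirPoly_smul (b : OrthonormalBasis ι ℝ E) (u : E) (c : ℝ) (q : MvPolynomial ι ℝ) :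
    dirPoly b u (c • q) = c • dirPoly b u q := by
  simp [dirPoly, Finset.smul_sum, smul_comm c]

omit [DecidableEq ι] in
/-- `D_u` is additive over finite sums in `q`. [folklore] -/
theorem dirPoly_sum {κ : Type*} (b : OrthonormalBasis ι ℝ E) (u : E) (s : Finset κ)
    (f : κ → MvPolynomial ι ℝ) : dirPoly b u (∑ k ∈ s, f k) = ∑ k ∈ s, dirPoly b u (f k) :=
  map_sum (AddMonoidHom.mk' (dirPoly b u) (dirPoly_add b u)) f s

omit [DecidableEq ι] in
/-- `D_{r u} = r D_u`. [folklore] -/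
theorem dirPoly_smul_left (b : OrthonormalBasis ι ℝ E) (r : ℝ) (u : E) (q : MvPolynomial ι ℝ) :
    dirPoly b (r • u) q = r • dirPoly b u q := by
  simp [dirPoly, inner_smul_right, Finset.smul_sum, smul_smul]

/-- `D_{bᵢ} = ∂ᵢ`. [folklore] -/
theorem dirPoly_basis (b : OrthonormalBasis ι ℝ E) (i : ι) (q : MvPolynomial ι ℝ) :
    dirPoly b (b i) q = MvPolynomial.pderiv i q := by
  classical
  unfold dirPoly
  simp_rw [orthonormal_iff_ite.1 b.orthonormal]
  simp [Finset.sum_ite_eq', ite_smul]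

/-- `D_u ∂ⱼ = ∂ⱼ D_u`. [folklore] -/
theorem dirPoly_pderiv (b : OrthonormalBasis ι ℝ E) (u : E) (j : ι) (q : MvPolynomial ι ℝ) :
    dirPoly b u (MvPolynomial.pderiv j q) = MvPolynomial.pderiv j (dirPoly b u q) := by
  simp only [dirPoly, map_sum, Derivation.map_smul]
  refine Finset.sum_congr rfl fun k _ => ?_
  rw [pderiv_pderiv_comm]

omit [DecidableEq ι] in
/-- `D_u D_u q = Σⱼₖ ⟪bⱼ,u⟫⟪bₖ,u⟫ ∂ⱼ∂ₖ q`. [folklore] -/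
theorem dirPoly_dirPoly (b : OrthonormalBasis ι ℝ E) (u : E) (q : MvPolynomial ι ℝ) :
    dirPoly b u (dirPoly b u q) =
      ∑ j, ∑ k, (⟪b j, u⟫_ℝ * ⟪b k, u⟫_ℝ) • MvPolynomial.pderiv j (MvPolynomial.pderiv k q) := by
  unfold dirPoly
  simp only [map_sum, Derivation.map_smul, Finset.smul_sum, smul_smul]

/-! ### The quadratic direction form `A_q(u) = ‖D_u q‖²` -/

/-- Coordinate expansion: `⟨D_u q, D_u q'⟩_F = Σⱼₖ ⟪bⱼ,u⟫⟪bₖ,u⟫ ⟨∂ⱼ q, ∂ₖ q'⟩_F`. [folklore] -/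
theorem fischerInner_dirPoly_dirPoly (b : OrthonormalBasis ι ℝ E) (u : E) (q q' : MvPolynomial ι ℝ) :
    fischerInner (dirPoly b u q) (dirPoly b u q') =
      ∑ j, ∑ k, ⟪b j, u⟫_ℝ * ⟪b k, u⟫_ℝ *
        fischerInner (MvPolynomial.pderiv j q) (MvPolynomial.pderiv k q') := by
  unfold dirPoly
  rw [fischerInner_sum_left]
  refine Finset.sum_congr rfl fun j _ => ?_
  rw [fischerInner_smul_left, fischerInner_sum_right, Finset.mul_sum]
  refine Finset.sum_congr rfl fun k _ => ?_
  rw [fischerInner_smul_right]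
  ring

/-- `A_q` is homogeneous of degree `2` in the direction. [folklore] -/
theorem fischerInner_dirPoly_smul (b : OrthonormalBasis ι ℝ E) (r : ℝ) (u : E)
    (q : MvPolynomial ι ℝ) :
    fischerInner (dirPoly b (r • u) q) (dirPoly b (r • u) q) =
      r ^ 2 * fischerInner (dirPoly b u q) (dirPoly b u q) := by
  rw [dirPoly_smul_left, fischerInner_smul_left, fischerInner_smul_right]
  ring

/-- `A_q` is continuous in the direction. [folklore] -/
theorem continuous_fischerInner_dirPoly (b : OrthonormalBasis ι ℝ E) (q : MvPolynomial ι ℝ) :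
    Continuous fun u : E => fischerInner (dirPoly b u q) (dirPoly b u q) := by
  simp_rw [fischerInner_dirPoly_dirPoly]
  fun_prop

section Gaussian

variable [FiniteDimensional ℝ E] [MeasurableSpace E] [BorelSpace E]

/-- `A_q` is integrable against the Maxwellian. [folklore] -/
theorem integrable_fischerInner_dirPoly (b : OrthonormalBasis ι ℝ E) (q : MvPolynomial ι ℝ) :
    Integrable (fun u : E => fischerInner (dirPoly b u q) (dirPoly b u q)) (stdGaussian E) := by
  simp_rw [fischerInner_dirPoly_dirPoly]
  exact integrable_finsetSum _ fun j _ => integrable_finsetSum _ fun k _ =>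
    (integrable_coord_mul_coord_stdGaussian b j k).mul_const _

/-- **Gaussian expectation of `A_q`**: `∫ ‖D_x q‖²_F dγ(x) = Σⱼ ‖∂ⱼ q‖²_F`. [folklore] -/
theorem integral_fischerInner_dirPoly (b : OrthonormalBasis ι ℝ E) (q : MvPolynomial ι ℝ) :
    ∫ u, fischerInner (dirPoly b u q) (dirPoly b u q) ∂stdGaussian E =
      ∑ j, fischerInner (MvPolynomial.pderiv j q) (MvPolynomial.pderiv j q) := by
  simp_rw [fischerInner_dirPoly_dirPoly]
  exact integral_quadForm_stdGaussian b _

/-- **Sphere average of `A_q`** for `q` homogeneous of degree `n`: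
`d · ∫_S ‖D_ω q‖²_F dσ(ω) = σ(S) · n ‖q‖²_F` (`d = |ι| = dim E ≥ 1`). [folklore] -/
theorem integral_sphere_dirFormA (b : OrthonormalBasis ι ℝ E) {q : MvPolynomial ι ℝ} {n : ℕ}
    (hq : q.IsHomogeneous n) (hE : 0 < finrank ℝ E) :
    (Fintype.card ι : ℝ) * ∫ ω : sphere (0 : E) 1, fischerInner (dirPoly b ω q) (dirPoly b ω q) ∂sphereMeasure =
      (sphereMeasure (univ : Set (sphere (0 : E) 1))).toReal * (n * fischerInner q q) := by
  have hmom : Integrable (fun x : E => ‖x‖ ^ 2) (stdGaussian E) :=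
    (integrable_finsetSum _ fun j _ => integrable_coord_mul_coord_stdGaussian b j j).congr
      (ae_of_all _ fun x => (norm_sq_eq_sum_coord_sq b x).symm)
  have h := moment_mul_integral_sphere_eq (k := 2) hE (continuous_fischerInner_dirPoly b q)
    (fun u => fischerInner_self_nonneg _)
    (fun r hr u => fischerInner_dirPoly_smul b r u q) (integrable_fischerInner_dirPoly b q) hmom
  rw [integral_norm_sq_stdGaussian b, integral_fischerInner_dirPoly, sum_fischerInner_pderiv_self hq] at h
  exact h

end Gaussian

/-! ### The quartic direction form `B_q(u) = ‖D_u D_u q‖²` -/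

/-- Coordinate expansion:
`‖D_u D_u q‖²_F = Σⱼₖₗₘ ⟪bⱼ,u⟫⟪bₖ,u⟫⟪bₗ,u⟫⟪bₘ,u⟫ ⟨∂ⱼ∂ₖ q, ∂ₗ∂ₘ q⟩_F`. [folklore] -/
theorem fischerInner_dirPoly_dirPoly_sq (b : OrthonormalBasis ι ℝ E) (u : E) (q : MvPolynomial ι ℝ) :
    fischerInner (dirPoly b u (dirPoly b u q)) (dirPoly b u (dirPoly b u q)) =
      ∑ j, ∑ k, ∑ l, ∑ m, ⟪b j, u⟫_ℝ * ⟪b k, u⟫_ℝ * ⟪b l, u⟫_ℝ * ⟪b m, u⟫_ℝ *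
        fischerInner (MvPolynomial.pderiv j (MvPolynomial.pderiv k q))
          (MvPolynomial.pderiv l (MvPolynomial.pderiv m q)) := by
  rw [dirPoly_dirPoly, fischerInner_sum_left]
  refine Finset.sum_congr rfl fun j _ => ?_
  rw [fischerInner_sum_left]
  refine Finset.sum_congr rfl fun k _ => ?_
  rw [fischerInner_smul_left, fischerInner_sum_right, Finset.mul_sum]
  refine Finset.sum_congr rfl fun l _ => ?_
  rw [fischerInner_sum_right, Finset.mul_sum]
  refine Finset.sum_congr rfl fun m _ => ?_
  rw [fischerInner_smul_right]
  ring

/-- `B_q` is homogeneous of degree `4` in the direction. [folklore] -/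
theorem fischerInner_dirPoly_dirPoly_smul (b : OrthonormalBasis ι ℝ E) (r : ℝ) (u : E)
    (q : MvPolynomial ι ℝ) :
    fischerInner (dirPoly b (r • u) (dirPoly b (r • u) q)) (dirPoly b (r • u) (dirPoly b (r • u) q)) =
      r ^ 4 * fischerInner (dirPoly b u (dirPoly b u q)) (dirPoly b u (dirPoly b u q)) := by
  rw [dirPoly_smul_left, dirPoly_smul_left, dirPoly_smul, smul_smul, fischerInner_smul_left,
    fischerInner_smul_right]
  ring

/-- `B_q` is continuous in the direction. [folklore] -/
theorem continuous_fischerInner_dirPoly_dirPoly (b : OrthonormalBasis ι ℝ E) (q : MvPolynomial ι ℝ) :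
    Continuous fun u : E =>
      fischerInner (dirPoly b u (dirPoly b u q)) (dirPoly b u (dirPoly b u q)) := by
  simp_rw [fischerInner_dirPoly_dirPoly_sq]
  fun_prop

section Gaussian

variable [FiniteDimensional ℝ E] [MeasurableSpace E] [BorelSpace E]

/-- `B_q` is integrable against the Maxwellian. [folklore] -/
theorem integrable_fischerInner_dirPoly_dirPoly (b : OrthonormalBasis ι ℝ E) (q : MvPolynomial ι ℝ) :
    Integrable (fun u : E =>
      fischerInner (dirPoly b u (dirPoly b u q)) (dirPoly b u (dirPoly b u q))) (stdGaussian E) := by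
  simp_rw [fischerInner_dirPoly_dirPoly_sq]
  exact integrable_finsetSum _ fun j _ => integrable_finsetSum _ fun k _ =>
    integrable_finsetSum _ fun l _ => integrable_finsetSum _ fun m _ =>
      (integrable_coord_four_stdGaussian b j k l m).mul_const _

/-- **Gaussian expectation of `B_q`** (Wick): `∫ ‖D_x D_x q‖²_F dγ(x) = ‖Δq‖²_F + 2 Σⱼₖ ‖∂ₖ∂ⱼ q‖²_F`. [folklore] -/
theorem integral_fischerInner_dirPoly_dirPoly (b : OrthonormalBasis ι ℝ E) (q : MvPolynomial ι ℝ) :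
    ∫ u, fischerInner (dirPoly b u (dirPoly b u q)) (dirPoly b u (dirPoly b u q)) ∂stdGaussian E =
      fischerInner (∑ j, MvPolynomial.pderiv j (MvPolynomial.pderiv j q))
          (∑ j, MvPolynomial.pderiv j (MvPolynomial.pderiv j q)) +
        2 * ∑ j, ∑ k, fischerInner (MvPolynomial.pderiv k (MvPolynomial.pderiv j q))
          (MvPolynomial.pderiv k (MvPolynomial.pderiv j q)) := by
  set F : ι → ι → ι → ι → ℝ := fun j k l m =>
    fischerInner (MvPolynomial.pderiv j (MvPolynomial.pderiv k q))
      (MvPolynomial.pderiv l (MvPolynomial.pderiv m q)) with hF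
  have hexp : ∀ u : E, fischerInner (dirPoly b u (dirPoly b u q)) (dirPoly b u (dirPoly b u q)) =
      ∑ j, ∑ k, ∑ l, ∑ m, ⟪b j, u⟫_ℝ * ⟪b k, u⟫_ℝ * ⟪b l, u⟫_ℝ * ⟪b m, u⟫_ℝ * F j k l m := fun u =>
    fischerInner_dirPoly_dirPoly_sq b u q
  rw [show (fun u : E => fischerInner (dirPoly b u (dirPoly b u q)) (dirPoly b u (dirPoly b u q))) =
      fun u => ∑ j, ∑ k, ∑ l, ∑ m, ⟪b j, u⟫_ℝ * ⟪b k, u⟫_ℝ * ⟪b l, u⟫_ℝ * ⟪b m, u⟫_ℝ * F j k l m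
    from funext hexp]
  have h4 := integral_quartForm_stdGaussian (E := E) b F
  rw [h4, two_mul, add_assoc]
  have e1 : (∑ j, ∑ l, F j j l l) = fischerInner (∑ j, MvPolynomial.pderiv j (MvPolynomial.pderiv j q))
      (∑ j, MvPolynomial.pderiv j (MvPolynomial.pderiv j q)) := by
    rw [hF, fischerInner_sum_left]
    refine Finset.sum_congr rfl fun j _ => ?_
    rw [fischerInner_sum_right]
  have e2 : (∑ j, ∑ k, F j k j k) = ∑ j, ∑ k, fischerInner (MvPolynomial.pderiv k (MvPolynomial.pderiv j q))
      (MvPolynomial.pderiv k (MvPolynomial.pderiv j q)) := by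
    refine Finset.sum_congr rfl fun j _ => Finset.sum_congr rfl fun k _ => ?_
    simp only [hF]
    rw [pderiv_pderiv_comm j k q]
  have e3 : (∑ j, ∑ k, F j k k j) = ∑ j, ∑ k, fischerInner (MvPolynomial.pderiv k (MvPolynomial.pderiv j q))
      (MvPolynomial.pderiv k (MvPolynomial.pderiv j q)) := by
    refine Finset.sum_congr rfl fun j _ => Finset.sum_congr rfl fun k _ => ?_
    simp only [hF]
    rw [pderiv_pderiv_comm j k q]
  rw [e1, e2, e3]

/-- **Sphere average of `B_q`** for `q` homogeneous of degree `n`: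
`d (d + 2) · ∫_S ‖D_ω D_ω q‖²_F dσ(ω) = σ(S) · (‖Δq‖²_F + 2 n (n - 1) ‖q‖²_F)`. [folklore] -/
theorem integral_sphere_dirFormB (b : OrthonormalBasis ι ℝ E) {q : MvPolynomial ι ℝ} {n : ℕ}
    (hq : q.IsHomogeneous n) (hE : 0 < finrank ℝ E) :
    ((Fintype.card ι : ℝ) * (Fintype.card ι + 2)) * ∫ ω : sphere (0 : E) 1,
        fischerInner (dirPoly b ω (dirPoly b ω q)) (dirPoly b ω (dirPoly b ω q)) ∂sphereMeasure =
      (sphereMeasure (univ : Set (sphere (0 : E) 1))).toReal *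
        (fischerInner (∑ j, MvPolynomial.pderiv j (MvPolynomial.pderiv j q))
            (∑ j, MvPolynomial.pderiv j (MvPolynomial.pderiv j q)) +
          2 * (n * (n - 1 : ℕ) * fischerInner q q)) := by
  have hmom : Integrable (fun x : E => ‖x‖ ^ 4) (stdGaussian E) := by
    have h := integrable_norm_pow_four_aux b
    exact h
  have h := moment_mul_integral_sphere_eq (k := 4) hE (continuous_fischerInner_dirPoly_dirPoly b q)
    (fun u => fischerInner_self_nonneg _)
    (fun r hr u => fischerInner_dirPoly_dirPoly_smul b r u q) (integrable_fischerInner_dirPoly_dirPoly b q)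
    hmom
  rw [integral_norm_pow_four_stdGaussian b, integral_fischerInner_dirPoly_dirPoly,
    sum_sum_fischerInner_pderiv_pderiv_self hq] at h
  exact h
where
  /-- `‖x‖⁴` is integrable (its integral was computed to be `d(d+2)`; a non-integrable function has
  Bochner integral `0 ≠ d(d+2)` unless `d = 0`, in which case `‖x‖⁴ = 0`). [folklore] -/
  integrable_norm_pow_four_aux (b : OrthonormalBasis ι ℝ E) :
      Integrable (fun x : E => ‖x‖ ^ 4) (stdGaussian E) := by
    have h : ∀ x : E, ‖x‖ ^ 4 = ∑ j, ∑ l, ⟪b j, x⟫_ℝ * ⟪b j, x⟫_ℝ * ⟪b l, x⟫_ℝ * ⟪b l, x⟫_ℝ := by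
      intro x
      rw [show (4 : ℕ) = 2 * 2 from rfl, pow_mul, norm_sq_eq_sum_coord_sq b, sq, Finset.sum_mul_sum]
      refine Finset.sum_congr rfl fun j _ => Finset.sum_congr rfl fun l _ => ?_
      ring
    simp_rw [h]
    exact integrable_finsetSum _ fun j _ => integrable_finsetSum _ fun l _ =>
      integrable_coord_four_stdGaussian b j j l l

end Gaussian

end

end Literature.Analysis.UnboundedOperators
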